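import Summits.HodgeConjecture.HodgeConjecture.Theorems.R90S9GlobalTraceLinearIndependence   -- ★ p862002 (p07): `globalCharactersLinIndep`; ★ p861956 FILE 1: `isCountablyLinIndepOn_comap`
import Summits.HodgeConjecture.HodgeConjecture.Theorems.R90S9InnerFormSec146Data              -- ★ ed. 1 (p01): `RepPrimeClass`, `classOf`, `mPrime` (the datum's `Rep′`, `m(π′)`)
import HarnessLib

/-!
# R90-TF · S9 «InnerForm-13.3.6 (c)» — hand #6: LINEAR INDEPENDENCE OF GLOBAL CHARACTERS AT THE DATUM CURRENCY
# (`IsCountablyLinIndepOn U 𝓕 tr′` for `tr′ = (trace on restricted pure tensors) ∘ ι`, `ι` any injective «local components» map of the datum's `Rep′`;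
# Rogawski 1990 Prop. 13.8.1 ∕ Jacquet–Langlands Lemma 16.1.1, from ★ p862002)

Cell `hodgecm-mathlib`, crux H413 (`stmt-HodgeConjecture-24833`), route of record `HCCMUnconditional`; programme R90-TF, section S9 (base `R90-IF`), seat R90-IF-p02 (g0);
R90-IF-plan DEAL (R90 bus 2026-09-04T21:28:02Z (6), 21:29:44Z): «p02 hand #6 = `Theorems/R90S9TraceLinIndepAtDatum.lean`: the `hli` ∕ `hsep` organ AT THE DATUM CURRENCY —
`IsCountablyLinIndepOn U 𝓕 tr′` for ANY `tr′ := (trace on level tests) ∘ ι` with `ι` an injective comap into the discrete automorphic spectrum of `U(H)` (★ p862002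
`globalCharactersLinIndep` + ★ p861956 `_comap`), stated over ★ ed. 1 `InnerFormSec146.RepPrimeClass` ∕ `classOf` so that p01's ED. 2 `tr′` slots in by `rfl`».  Helper file, lane
`--supports stmt-HodgeConjecture-24833 --as helper`; theorems only (no definition, no instance, no notation, no named fact, no `sorry`).
HONEST LABEL: HC_CM is proved only modulo the 7 printed citations (2 remaining named inputs: hLiu418 = stmt-HodgeConjecture-24832, h413 = stmt-HodgeConjecture-24833) until
rung 0 closes; this file proves no new printed statement: it RE-READS ★ p862002 (the global linear independence of characters of `G′_∞/K_c × ∏′_v G′_v`, `G′ = U(H)`)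
in the ★ `IsCountablyLinIndepOn` currency of the (14.6) cuts (★ p862147 `sec146_of_parts`, ★ p862188 `hmn_of_mnNeZero_abstract` binder `hli`, ★ p862176∕p862181 (CMP))
and pulls it back to ANY index of global representations with an injective «components» map — in particular p01's datum carrier ★ `InnerFormSec146.RepPrimeClass L H μA`.

## Contents (all proved; sizes S)
* §1 `globalCharactersLinIndep_isCountablyLinIndepOn` — ★ p862002 AS `IsCountablyLinIndepOn U₀ 𝓕₀ Θ₀` on the component index
  `X = GKIrrClass U(2,1) × ∏_v IrrClass U(H)_v`: support `U₀` = «`x.1` coh-unitary admissible, every `x.2 v` unitarizable, `tr (x.2 v)(e_v) = 1` for almost all `v`», tests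
  `𝓕₀` = restricted pure tensors `(φ, (f_v)_v)` (`φ ∈ ArchTestKc`, `f_v ∈ C_c^∞`, `f_v = e_v` a.a. `v`), characters `Θ₀ x (φ, f) = archTr₀ x.1 φ · ∏ᶠ_v tr (x.2 v)(f_v)` (uncurrying only).
* §2 `isCountablyLinIndepOn_of_components` — for ANY index type `I′` and ANY injective `ι : I′ → X` with `ι(U′) ⊆ U₀`, the composed characters `tr′ i′ := Θ₀ (ι i′)` (or any
  family agreeing with them on `U′ × 𝓕₀`) are countably linearly independent on `U′` against `𝓕₀` (★ `isCountablyLinIndepOn_comap`) — «`π′ ↦ (π′_∞, (π′_v)_v)` is injective»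
  [FlathCorvallis1979, Thm. 3] is the consumer's `hι`.
* §3 `traceLinIndep_repPrimeClass` — §2 at `I′ := InnerFormSec146.RepPrimeClass L H μA` (★ ed. 1, the datum's `Rep′`), support `U′ ⊇ {π′ | m(π′) ≠ 0}`-shaped sets allowed: the `hli` binder of
  ★ `hmn_of_mnNeZero_abstract` ∕ the `hli` input of ★ `hcoeff_of_expansion` at `Γ₀.tr′ := fun π′ φf => Θ₀ (ι π′) φf` — p01's ED. 2 `tr′` of this shape slots in by `rfl`
  (the agreement hypothesis `htr` also admits a `tr′` defined otherwise but provably equal on discrete classes × tests).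
ED. 2 (append-only, R90-IF-plan 21:39:45Z (2)): §4 `Set.InjOn` variants `isCountablyLinIndepOn_comap_injOn`, `isCountablyLinIndepOn_of_components_injOn`,
`traceLinIndep_repPrimeClass_injOn` (injectivity on the support set only).
NOT here: the construction of `ι` (the components record of a discrete automorphic `P`: `(P_∞|_{K_c}-class, (P_v)_v)` — p01's ED. 2 ∕ ★ `F0P3XiPacketFamilyOfRecord` currency)
and its injectivity (multiplicity-one-free: injective on UNITARY-EQUIVALENCE classes by [FlathCorvallis1979, Thm. 3] + [BorelJacquet1979, §4.6]); both are binders.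

## References
[Rogawski1990] §13.8 Prop. 13.8.1 p. 212; §14.6 Thm. 14.6.4 p. 244.  [JacquetLanglands1970] Lemma 16.1.1 pp. 497–499.  [FlathCorvallis1979] Thm. 3.  [LabesseLanglands1979] Lemma 6.1.
-/

set_option autoImplicit false
-- the mandated namespace repeats `HodgeConjecture.HodgeConjecture`, as in every `Theorems/*.lean` of this sub-problem
set_option linter.dupNamespace false

noncomputable section

namespace Summit.HodgeConjecture.HodgeConjecture.R90.S9

open Literature.NumberTheory.Automorphic
open NumberField IsDedekindDomain MeasureTheory
open Literature.NumberTheory.Rogawski1990 Literature.NumberTheory.Automorphic.UnitaryGroup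
open Literature.RepresentationTheory.KonnoKonno2007
open scoped Matrix Classical ComplexOrder

section Datum

variable (L : Type) [Field L] [NumberField L] [IsCMField L] (ι₀ : L →+* ℂ) (H : Matrix (Fin 3) (Fin 3) L)
  (T : GL (Fin 3) ℂ) (hT : (T : Matrix (Fin 3) (Fin 3) ℂ)ᴴ * H.map ι₀ * (T : Matrix (Fin 3) (Fin 3) ℂ) = Literature.Geometry.ComplexHyperbolic.BallModel.J)
  (νinf : @Measure (UnitaryGroup.arch (↥(maximalRealSubfield L)) L (IsCMField.complexConj L) 3 H) (borel _))
  (μv : ∀ v : HeightOneSpectrum (𝓞 ↥(maximalRealSubfield L)), @Measure ((cmDatum L 3 H).Local v) (borel _))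
  (hdef : ∀ τ' : L →+* ℂ, InfinitePlace.mk τ' ≠ InfinitePlace.mk ι₀ → (H.map τ').PosDef)
  (hν : @Measure.IsHaarMeasure _ _ _ (borel _) νinf)
  (hμ : ∀ v : HeightOneSpectrum (𝓞 ↥(maximalRealSubfield L)), @Measure.IsHaarMeasure _ _ _ (borel _) (μv v))
  (e : ∀ v : HeightOneSpectrum (𝓞 ↥(maximalRealSubfield L)), (cmDatum L 3 H).Local v → ℂ)
  (he : ∀ v, IsLocallyConstant (e v) ∧ HasCompactSupport (e v))

/-! ## §1 ★ p862002 in `IsCountablyLinIndepOn` currency -/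

include hdef hν hμ he in
/-- **Global linear independence of characters, `IsCountablyLinIndepOn` form** (★ `globalCharactersLinIndep` uncurried): on the component index
`X = GKIrrClass U(2,1) × ∏_v IrrClass U(H)(L⁺_v)`, with support `U₀` = {`x.1` has an admissible representative infinitesimally unitary along `𝔭 ⊕ ℝz₀`, every `x.2 v`
unitarizable, `tr (x.2 v)(e_v) = 1` for all but finitely many `v`}, tests `𝓕₀` = restricted pure tensors `(φ, f)` (`φ ∈ ArchTestKc`, `f_v ∈ C_c^∞(U(H)_v)`, `f_v = e_v` for almost
all `v`) and characters `Θ₀ x (φ, f) = archTr₀ x.1 φ · ∏ᶠ_v tr (x.2 v)(f_v)`: `IsCountablyLinIndepOn U₀ 𝓕₀ Θ₀`.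
[cite: Rogawski1990, Prop. 13.8.1 p. 212] [cite: JacquetLanglands1970, Lemma 16.1.1 pp. 497–499] [cite: FlathCorvallis1979, Thm. 3] -/
theorem globalCharactersLinIndep_isCountablyLinIndepOn :
    IsCountablyLinIndepOn
      {x : GKIrrClass (uFormGroup (Fin 2) (Fin 1)) × (∀ v : HeightOneSpectrum (𝓞 ↥(maximalRealSubfield L)), IrrClass ((cmDatum L 3 H).Local v)) |
        (∃ r : GKIrrep (uFormGroup (Fin 2) (Fin 1)), GKIrrClass.mk r = x.1 ∧ IsAdmissibleGK r.ρK ∧ r.IsInfUnitaryAlongP) ∧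
          (∀ v, (x.2 v).IsUnitarizable) ∧
          {v | (letI : MeasurableSpace ((cmDatum L 3 H).Local v) := borel _; (x.2 v).smoothTrace (μv v) (e v)) ≠ 1}.Finite}
      (fun φf : (UnitaryGroup.arch (↥(maximalRealSubfield L)) L (IsCMField.complexConj L) 3 H → ℂ) ×
          (∀ v : HeightOneSpectrum (𝓞 ↥(maximalRealSubfield L)), (cmDatum L 3 H).Local v → ℂ) =>
        ArchTestKc L ι₀ H T hT φf.1 ∧ (∀ v, IsLocallyConstant (φf.2 v) ∧ HasCompactSupport (φf.2 v)) ∧ {v | φf.2 v ≠ e v}.Finite)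
      (fun x φf => archTr₀ L ι₀ H T hT νinf x.1 φf.1 *
        ∏ᶠ v, (letI : MeasurableSpace ((cmDatum L 3 H).Local v) := borel _; (x.2 v).smoothTrace (μv v) (φf.2 v))) := by
  intro a ha hs h0 x
  exact globalCharactersLinIndep L ι₀ H T hT νinf μv hdef hν hμ e he a (fun y hy => ha y hy)
    (fun φ f h1 h2 h3 => hs (φ, f) ⟨h1, h2, h3⟩) (fun φ f h1 h2 h3 => h0 (φ, f) ⟨h1, h2, h3⟩) x

/-! ## §2 Pull-back to ANY index of global representations along an injective components map -/

include hdef hν hμ he in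
/-- **Linear independence of characters for ANY family of global representations with an injective «local components» map.**  For an index type `I′`, an
INJECTIVE `ι : I′ → X` («`π′ ↦ (π′_∞, (π′_v)_v)`», [FlathCorvallis1979, Thm. 3]), a support set `U′` with `ι(U′) ⊆ U₀` (coh-unitary ∕ unitarizable ∕ almost everywhere
`e`-spherical components — automatic for discrete automorphic `π′`), and characters `tr′ : I′ → 𝓕₀-tests → ℂ` agreeing with `Θ₀ ∘ ι` on `U′ × 𝓕₀` (`htr`; `rfl` when
`tr′ := Θ₀ ∘ ι`): `IsCountablyLinIndepOn U′ 𝓕₀ tr′` — ★ `isCountablyLinIndepOn_comap` at §1.  This is the `hli` binder of ★ `hmn_of_mnNeZero_abstract` (p862188) and the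
`hli` input of ★ `hcoeff_of_expansion` (p862181) ∕ `hcoeff_of_hasSum_expansion` (p862176) at a datum whose `tr′` is of this shape.
[cite: Rogawski1990, Prop. 13.8.1 p. 212; §14.6 Thm. 14.6.4 p. 244] [cite: FlathCorvallis1979, Thm. 3] [cite: JacquetLanglands1970, Lemma 16.1.1] -/
theorem isCountablyLinIndepOn_of_components {I' : Type*}
    (ι : I' → GKIrrClass (uFormGroup (Fin 2) (Fin 1)) × (∀ v : HeightOneSpectrum (𝓞 ↥(maximalRealSubfield L)), IrrClass ((cmDatum L 3 H).Local v)))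
    (hι : Function.Injective ι) (U' : Set I')
    (hU' : ∀ i' ∈ U',
      (∃ r : GKIrrep (uFormGroup (Fin 2) (Fin 1)), GKIrrClass.mk r = (ι i').1 ∧ IsAdmissibleGK r.ρK ∧ r.IsInfUnitaryAlongP) ∧
        (∀ v, ((ι i').2 v).IsUnitarizable) ∧
        {v | (letI : MeasurableSpace ((cmDatum L 3 H).Local v) := borel _; ((ι i').2 v).smoothTrace (μv v) (e v)) ≠ 1}.Finite)
    (tr' : I' → (UnitaryGroup.arch (↥(maximalRealSubfield L)) L (IsCMField.complexConj L) 3 H → ℂ) ×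
      (∀ v : HeightOneSpectrum (𝓞 ↥(maximalRealSubfield L)), (cmDatum L 3 H).Local v → ℂ) → ℂ)
    (htr : ∀ i' ∈ U', ∀ φf, (ArchTestKc L ι₀ H T hT φf.1 ∧ (∀ v, IsLocallyConstant (φf.2 v) ∧ HasCompactSupport (φf.2 v)) ∧ {v | φf.2 v ≠ e v}.Finite) →
      tr' i' φf = archTr₀ L ι₀ H T hT νinf (ι i').1 φf.1 *
        ∏ᶠ v, (letI : MeasurableSpace ((cmDatum L 3 H).Local v) := borel _; ((ι i').2 v).smoothTrace (μv v) (φf.2 v))) :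
    IsCountablyLinIndepOn U'
      (fun φf : (UnitaryGroup.arch (↥(maximalRealSubfield L)) L (IsCMField.complexConj L) 3 H → ℂ) ×
          (∀ v : HeightOneSpectrum (𝓞 ↥(maximalRealSubfield L)), (cmDatum L 3 H).Local v → ℂ) =>
        ArchTestKc L ι₀ H T hT φf.1 ∧ (∀ v, IsLocallyConstant (φf.2 v) ∧ HasCompactSupport (φf.2 v)) ∧ {v | φf.2 v ≠ e v}.Finite)
      tr' :=
  isCountablyLinIndepOn_comap (globalCharactersLinIndep_isCountablyLinIndepOn L ι₀ H T hT νinf μv hdef hν hμ e he) ι hι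
    (fun i' hi' => hU' i' hi') (fun i' hi' φf hφf => htr i' hi' φf hφf)

/-! ## §3 At the datum's `Rep′ = InnerFormSec146.RepPrimeClass L H μA` (★ ed. 1) -/

include hdef hν hμ he in
/-- **`hli` AT THE DATUM CARRIER.**  For the datum's `Rep′ = InnerFormSec146.RepPrimeClass L H μA` (unitary-equivalence classes of discrete automorphic representations of `U(H)`, ★ ed. 1)
and ANY injective components map `ι : InnerFormSec146.RepPrimeClass L H μA → X` whose values on the support set `U′` (e.g. `{π′ | mPrime π′ ≠ 0}`, or all of `Rep′`) satisfy the three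
support conditions of ★ p862002: the characters `tr′ π′ := (φ, f) ↦ archTr₀ (ι π′).1 φ · ∏ᶠ_v tr ((ι π′).2 v)(f_v)` — or any `tr′` agreeing with them on `U′ × 𝓕₀` — are
countably linearly independent on `U′` against the restricted pure tensors `𝓕₀`.  (p01's ED. 2 `Γ₀.tr′` of this shape slots in with `htr := fun _ _ _ _ => rfl`.)
[cite: Rogawski1990, Prop. 13.8.1 p. 212; §14.5 p. 237; §14.6 Thm. 14.6.4 p. 244] [cite: FlathCorvallis1979, Thm. 3] -/
theorem traceLinIndep_repPrimeClass
    (μA : Measure (adelicGroupData (↥(maximalRealSubfield L)) L (IsCMField.complexConj L) 3 H).automorphicQuotient)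
    [(adelicGroupData (↥(maximalRealSubfield L)) L (IsCMField.complexConj L) 3 H).IsAutomorphicMeasure μA]
    (ι : InnerFormSec146.RepPrimeClass L H μA →
      GKIrrClass (uFormGroup (Fin 2) (Fin 1)) × (∀ v : HeightOneSpectrum (𝓞 ↥(maximalRealSubfield L)), IrrClass ((cmDatum L 3 H).Local v)))
    (hι : Function.Injective ι) (U' : Set (InnerFormSec146.RepPrimeClass L H μA))
    (hU' : ∀ π' ∈ U',
      (∃ r : GKIrrep (uFormGroup (Fin 2) (Fin 1)), GKIrrClass.mk r = (ι π').1 ∧ IsAdmissibleGK r.ρK ∧ r.IsInfUnitaryAlongP) ∧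
        (∀ v, ((ι π').2 v).IsUnitarizable) ∧
        {v | (letI : MeasurableSpace ((cmDatum L 3 H).Local v) := borel _; ((ι π').2 v).smoothTrace (μv v) (e v)) ≠ 1}.Finite)
    (tr' : InnerFormSec146.RepPrimeClass L H μA → (UnitaryGroup.arch (↥(maximalRealSubfield L)) L (IsCMField.complexConj L) 3 H → ℂ) ×
      (∀ v : HeightOneSpectrum (𝓞 ↥(maximalRealSubfield L)), (cmDatum L 3 H).Local v → ℂ) → ℂ)
    (htr : ∀ π' ∈ U', ∀ φf, (ArchTestKc L ι₀ H T hT φf.1 ∧ (∀ v, IsLocallyConstant (φf.2 v) ∧ HasCompactSupport (φf.2 v)) ∧ {v | φf.2 v ≠ e v}.Finite) →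
      tr' π' φf = archTr₀ L ι₀ H T hT νinf (ι π').1 φf.1 *
        ∏ᶠ v, (letI : MeasurableSpace ((cmDatum L 3 H).Local v) := borel _; ((ι π').2 v).smoothTrace (μv v) (φf.2 v))) :
    IsCountablyLinIndepOn U'
      (fun φf : (UnitaryGroup.arch (↥(maximalRealSubfield L)) L (IsCMField.complexConj L) 3 H → ℂ) ×
          (∀ v : HeightOneSpectrum (𝓞 ↥(maximalRealSubfield L)), (cmDatum L 3 H).Local v → ℂ) =>
        ArchTestKc L ι₀ H T hT φf.1 ∧ (∀ v, IsLocallyConstant (φf.2 v) ∧ HasCompactSupport (φf.2 v)) ∧ {v | φf.2 v ≠ e v}.Finite)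
      tr' :=
  isCountablyLinIndepOn_of_components L ι₀ H T hT νinf μv hdef hν hμ e he ι hι U' hU' tr' htr

/-! ## §4 (ED. 2, append-only) The `Set.InjOn` variants — injectivity of the components map ON THE SUPPORT SET only (R90-IF-plan 21:39:45Z (2)) -/

/-- **Countable linear independence pulls back along a map injective ON THE NEW SUPPORT SET** (`Set.InjOn ψ U′`; ★ `isCountablyLinIndepOn_comap` asks global
injectivity): restrict to the subtype `U′` (where `ψ` IS injective), pull back, and return to `I′` through `Summable.subtype` ∕ `tsum_subtype_eq_of_support_subset`
(a coefficient family supported in `U′` has the same sums on `I′` and on the subtype). [cite: FlathCorvallis1979, Thm. 3] [cite: Rogawski1990, Prop. 13.8.1 p. 212] -/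
theorem isCountablyLinIndepOn_comap_injOn {I : Type*} {I' : Type*} {Φ : Type*} {U : Set I} {P : Φ → Prop} {Θ : I → Φ → ℂ}
    (hΘ : IsCountablyLinIndepOn U P Θ) (ψ : I' → I) {U' : Set I'} (hψ : Set.InjOn ψ U') (hU : ∀ i', i' ∈ U' → ψ i' ∈ U)
    {Θ' : I' → Φ → ℂ} (hΘ' : ∀ i' ∈ U', ∀ φ, P φ → Θ' i' φ = Θ (ψ i') φ) :
    IsCountablyLinIndepOn U' P Θ' := by
  -- the pulled-back family on the subtype `U′`, where `ψ` is injective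
  have hsub : IsCountablyLinIndepOn (Set.univ : Set U') P (fun j φ => Θ' j.1 φ) :=
    isCountablyLinIndepOn_comap hΘ (fun j : U' => ψ j.1) (fun j j' h => Subtype.ext (hψ j.2 j'.2 h)) (fun j _ => hU j.1 j.2)
      (fun j _ φ hφ => hΘ' j.1 j.2 φ hφ)
  intro b hb hs h0 i'
  by_cases hi' : i' ∈ U'
  · have hsupp : ∀ φ, (Function.support fun j : I' => b j * Θ' j φ) ⊆ U' := fun φ j hj => by
      by_contra hjU
      exact hj (show b j * Θ' j φ = 0 by rw [show b j = 0 from Classical.byContradiction fun h => hjU (hb j h), zero_mul])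
    have key := hsub (fun j : U' => b j.1) (fun j _ => Set.mem_univ j)
      (fun φ hφ => (hs φ hφ).subtype _)
      (fun φ hφ => by rw [tsum_subtype_eq_of_support_subset (hsupp φ), h0 φ hφ]) ⟨i', hi'⟩
    exact key
  · by_contra h
    exact hi' (hb i' h)

include hdef hν hμ he in
/-- **§2 with `Set.InjOn`**: the components map need only be injective ON `U′` (e.g. on the discrete ∕ spherical classes — a LEMMA from Flath at the datum, never a binder on
all of `I′`). [cite: Rogawski1990, Prop. 13.8.1 p. 212; §14.6 Thm. 14.6.4 p. 244] [cite: FlathCorvallis1979, Thm. 3] -/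
theorem isCountablyLinIndepOn_of_components_injOn {I' : Type*}
    (ι : I' → GKIrrClass (uFormGroup (Fin 2) (Fin 1)) × (∀ v : HeightOneSpectrum (𝓞 ↥(maximalRealSubfield L)), IrrClass ((cmDatum L 3 H).Local v)))
    (U' : Set I') (hι : Set.InjOn ι U')
    (hU' : ∀ i' ∈ U',
      (∃ r : GKIrrep (uFormGroup (Fin 2) (Fin 1)), GKIrrClass.mk r = (ι i').1 ∧ IsAdmissibleGK r.ρK ∧ r.IsInfUnitaryAlongP) ∧
        (∀ v, ((ι i').2 v).IsUnitarizable) ∧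
        {v | (letI : MeasurableSpace ((cmDatum L 3 H).Local v) := borel _; ((ι i').2 v).smoothTrace (μv v) (e v)) ≠ 1}.Finite)
    (tr' : I' → (UnitaryGroup.arch (↥(maximalRealSubfield L)) L (IsCMField.complexConj L) 3 H → ℂ) ×
      (∀ v : HeightOneSpectrum (𝓞 ↥(maximalRealSubfield L)), (cmDatum L 3 H).Local v → ℂ) → ℂ)
    (htr : ∀ i' ∈ U', ∀ φf, (ArchTestKc L ι₀ H T hT φf.1 ∧ (∀ v, IsLocallyConstant (φf.2 v) ∧ HasCompactSupport (φf.2 v)) ∧ {v | φf.2 v ≠ e v}.Finite) →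
      tr' i' φf = archTr₀ L ι₀ H T hT νinf (ι i').1 φf.1 *
        ∏ᶠ v, (letI : MeasurableSpace ((cmDatum L 3 H).Local v) := borel _; ((ι i').2 v).smoothTrace (μv v) (φf.2 v))) :
    IsCountablyLinIndepOn U'
      (fun φf : (UnitaryGroup.arch (↥(maximalRealSubfield L)) L (IsCMField.complexConj L) 3 H → ℂ) ×
          (∀ v : HeightOneSpectrum (𝓞 ↥(maximalRealSubfield L)), (cmDatum L 3 H).Local v → ℂ) =>
        ArchTestKc L ι₀ H T hT φf.1 ∧ (∀ v, IsLocallyConstant (φf.2 v) ∧ HasCompactSupport (φf.2 v)) ∧ {v | φf.2 v ≠ e v}.Finite)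
      tr' :=
  isCountablyLinIndepOn_comap_injOn (globalCharactersLinIndep_isCountablyLinIndepOn L ι₀ H T hT νinf μv hdef hν hμ e he) ι hι
    (fun i' hi' => hU' i' hi') (fun i' hi' φf hφf => htr i' hi' φf hφf)

include hdef hν hμ he in
/-- **§3 with `Set.InjOn`** at the datum carrier `InnerFormSec146.RepPrimeClass L H μA` (or any sub-carrier such as the spherical classes of p01's ED. 2): injectivity of
`ι` on `U′` only. [cite: Rogawski1990, Prop. 13.8.1 p. 212; §14.5 p. 237; §14.6 Thm. 14.6.4 p. 244] [cite: FlathCorvallis1979, Thm. 3] -/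
theorem traceLinIndep_repPrimeClass_injOn
    (μA : Measure (adelicGroupData (↥(maximalRealSubfield L)) L (IsCMField.complexConj L) 3 H).automorphicQuotient)
    [(adelicGroupData (↥(maximalRealSubfield L)) L (IsCMField.complexConj L) 3 H).IsAutomorphicMeasure μA]
    (ι : InnerFormSec146.RepPrimeClass L H μA →
      GKIrrClass (uFormGroup (Fin 2) (Fin 1)) × (∀ v : HeightOneSpectrum (𝓞 ↥(maximalRealSubfield L)), IrrClass ((cmDatum L 3 H).Local v)))
    (U' : Set (InnerFormSec146.RepPrimeClass L H μA)) (hι : Set.InjOn ι U')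
    (hU' : ∀ π' ∈ U',
      (∃ r : GKIrrep (uFormGroup (Fin 2) (Fin 1)), GKIrrClass.mk r = (ι π').1 ∧ IsAdmissibleGK r.ρK ∧ r.IsInfUnitaryAlongP) ∧
        (∀ v, ((ι π').2 v).IsUnitarizable) ∧
        {v | (letI : MeasurableSpace ((cmDatum L 3 H).Local v) := borel _; ((ι π').2 v).smoothTrace (μv v) (e v)) ≠ 1}.Finite)
    (tr' : InnerFormSec146.RepPrimeClass L H μA → (UnitaryGroup.arch (↥(maximalRealSubfield L)) L (IsCMField.complexConj L) 3 H → ℂ) ×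
      (∀ v : HeightOneSpectrum (𝓞 ↥(maximalRealSubfield L)), (cmDatum L 3 H).Local v → ℂ) → ℂ)
    (htr : ∀ π' ∈ U', ∀ φf, (ArchTestKc L ι₀ H T hT φf.1 ∧ (∀ v, IsLocallyConstant (φf.2 v) ∧ HasCompactSupport (φf.2 v)) ∧ {v | φf.2 v ≠ e v}.Finite) →
      tr' π' φf = archTr₀ L ι₀ H T hT νinf (ι π').1 φf.1 *
        ∏ᶠ v, (letI : MeasurableSpace ((cmDatum L 3 H).Local v) := borel _; ((ι π').2 v).smoothTrace (μv v) (φf.2 v))) :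
    IsCountablyLinIndepOn U'
      (fun φf : (UnitaryGroup.arch (↥(maximalRealSubfield L)) L (IsCMField.complexConj L) 3 H → ℂ) ×
          (∀ v : HeightOneSpectrum (𝓞 ↥(maximalRealSubfield L)), (cmDatum L 3 H).Local v → ℂ) =>
        ArchTestKc L ι₀ H T hT φf.1 ∧ (∀ v, IsLocallyConstant (φf.2 v) ∧ HasCompactSupport (φf.2 v)) ∧ {v | φf.2 v ≠ e v}.Finite)
      tr' :=
  isCountablyLinIndepOn_of_components_injOn L ι₀ H T hT νinf μv hdef hν hμ e he ι U' hι hU' tr' htr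

end Datum

end Summit.HodgeConjecture.HodgeConjecture.R90.S9

end
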